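import Mathlib
import Summits.ResolutionOfSingularities.ResolutionOfSingularities.Theorems.WeightedInvariantLocalWeightedDropTOT2CurveConflict
import Summits.ResolutionOfSingularities.ResolutionOfSingularities.Theorems.WeightedInvariantLocalWeightedDropPolyDescentTailTools

/-!
# `LocalWeightedDrop`, NC count game — TOT2-LINE piece S-CRV (v1.1 (D)), part 2: graph branches under RE-PREPARATION and at the
# TRANSLATED point of the `u₁`-chart (the (K2) / transverse successor)

[OURS · L1 W4.3 · chain w43, engine crux `LocalWeightedDrop` stmt-ResolutionOfSingularities-8899; sub-line under the v32 registered stub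
`stub_spaceNCRankDrop`, design memo `L/res-L1-w43-lead-1/g4/TOT2-LINE.md` v1.1 ADDENDUM (D); piece S-CRV = res-type-088 (res-L1-w43-plan-1 DEALS
gen 10 #9); design note `plan/tools/res-type-088/S-CRV-D-DESIGN.md` facts (F2)/(F3); `--supports 8899 --as helper`, counted 0; definition-free;
nothing here is a statement of any manuscript; AI-written (gate-accepted = sorry-free with standard axioms, not refereed).]

Part 1 (`…TOT2CurveConflict`, fact (F1)) follows a permissible graph branch `V(y + ψ, u₂ + u₁h(u₁))` of a label `A` through the ORIGIN of the
`u₁`-chart when it is tangent to `V(u₂)` (`h = u₁h₁`).  Here: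
* (F2) **`isPermissibleTwoT_graph_recentre`**, `hasGraphCurveT_shift` — the branch data survive any RE-CENTRING `y ↦ y + ψ₀` of the label
  (`PolyDescent.prep`): witness `(h, ψ − ψ₀(u₁, u₂ + u₁h))` (pure algebra: `shearT_shift` + `shift_shift`);
* (F3) `shearT_C_add_X_mul` (splitting `h = λ + u₁h₁` into the linear shear by `λ` and a tangent datum) and
  **`graph_blowOneT_translate`** — for ANY `h` with `h(0) = λ`, the branch's successor under the point blow-up is the TRANSLATED `u₁`-chart
  point `λ` (succT's third family `blowOneT d (prep d (shearT (C λ) A))`): there it is the permissible graph branch with datum `h₁` of the label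
  `blowOneT d (shift d (shearT (C λ) A) ψ₀)` for every preparing re-centring `ψ₀` (given as data with `ψ₀(0) = 0` and the position property of
  the re-centred label, as `IsPrepRecentring` supplies).  With `λ = 0` this is (F1)+(F2); with `λ ≠ 0` it is the (K2)/transverse case, where
  no boundary letter's strict transform passes through the successor (S-SET's `newLetters`), so the conflict is resolved in one step.
* (F4) **`graph_divOneT`** — NO RAISE under succT's first move: if `V(y, u₁)` is permissible and blown up (`divOneT`), a permissible graph branch
  persists at the (unique) near point with the SAME datum `h`; tools `isPermissibleTwoT_shift_killTwo` (the re-centring may be taken `u₂`-free: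
  canonical presentation of the branch), `isPermissibleTwoT_shift_X_one_mul`, `isPermissibleOneT_shearT`, `isPermissibleTwoT_divOneT`.
-/

set_option linter.dupNamespace false -- mandated namespace of this single-conjunct summit

noncomputable section

namespace Summit.ResolutionOfSingularities.ResolutionOfSingularities.Theorems

namespace TOT2Curve

open MvPowerSeries PolyDescent MonicDescent WildMonic Literature.AlgebraicGeometry.Resolution

variable {k : Type} [Field k] {d : ℕ}

/-- A shear keeps a zero constant term. -/
theorem constantCoeff_shear_eq_zero (h g : MvPowerSeries (Fin 2) k) (hg : constantCoeff g = 0) : constantCoeff (shear h g) = 0 := by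
  rw [← one_le_order_iff_constCoeff_eq_zero] at hg ⊢
  rw [shear_eq]
  exact le_trans hg (FormalShear.order_le_order_subst' _ (constantCoeff_shearFamily _) g)

/-! ## (F2) Re-centring invariance of graph branches -/

/-- **(F2)** If the graph curve `V(y + ψ, u₂ + u₁h)` is permissible for `A`, then for every re-centring `ψ₀` the SAME curve, written
`V(y′ + (ψ − ψ₀(u₁, u₂+u₁h)), u₂ + u₁h)` in `y′ = y + ψ₀`, is permissible for `shift d A ψ₀`. -/
theorem isPermissibleTwoT_graph_recentre (h : MvPowerSeries (Fin 2) k) (A : Fin d → MvPowerSeries (Fin 2) k) (ψ ψ₀ : MvPowerSeries (Fin 2) k)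
    (hperm : IsPermissibleTwoT d (shift d (shearT h A) ψ)) :
    IsPermissibleTwoT d (shift d (shearT h (shift d A ψ₀)) (ψ - shear h ψ₀)) := by
  rwa [shearT_shift, shift_shift, sub_add_cancel]

/-- `HasGraphCurveT` is invariant under re-centrings `y ↦ y + ψ₀` with `ψ₀(0) = 0`. -/
theorem hasGraphCurveT_shift {A : Fin d → MvPowerSeries (Fin 2) k} (hA : HasGraphCurveT d A) (ψ₀ : MvPowerSeries (Fin 2) k)
    (hψ₀ : constantCoeff ψ₀ = 0) : HasGraphCurveT d (shift d A ψ₀) := by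
  obtain ⟨h, ψ, hh, hψ, hperm⟩ := hA
  refine ⟨h, ψ - shear h ψ₀, hh, ?_, isPermissibleTwoT_graph_recentre h A ψ ψ₀ hperm⟩
  rw [map_sub, hψ, constantCoeff_shear_eq_zero h ψ₀ hψ₀, sub_zero]

/-! ## (F3) The translated `u₁`-chart point -/

/-- Splitting a shear: `A(u₁, u₂ + u₁(λ + u₁h₁)) = (A(u₁, u₂ + λu₁))(u₁, u₂ + u₁·u₁h₁)`. -/
theorem shearT_C_add_X_mul (la : k) (h₁ : MvPowerSeries (Fin 2) k) (A : Fin d → MvPowerSeries (Fin 2) k) :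
    shearT (C la + X 0 * h₁) A = shearT (X 0 * h₁) (shearT (C la) A) := by
  funext j
  show shear (C la + X 0 * h₁) (A j) = shear (X 0 * h₁) (shear (C la) (A j))
  rw [shear_shear_of_noY _ _ _ (fun e he => by rw [coeff_C, if_neg (fun h0 => he (by rw [h0]; rfl))]), add_comm]

/-- A shear by a series keeps positions (`ord` does not drop under the constant-free substitution). -/
theorem isPosT_shearT (h : MvPowerSeries (Fin 2) k) {A : Fin d → MvPowerSeries (Fin 2) k} (hA : IsPosT d A) : IsPosT d (shearT h A) :=
  fun j => lt_of_lt_of_le (hA j) (by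
    show (A j).order ≤ (shear h (A j)).order
    rw [shear_eq]
    exact FormalShear.order_le_order_subst' _ (constantCoeff_shearFamily _) (A j))

/-- **(F3) THE BRANCH AT THE TRANSLATED POINT.**  Let `A` be a label, `h = λ + u₁·h₁` (`h₁ = h₁(u₁)`), `ψ(0) = 0`, and let the graph curve
`V(y + ψ, u₂ + u₁h)` be permissible for `A`.  Let `ψ₀` be a re-centring of the linearly sheared label `shearT (C λ) A` with `ψ₀(0) = 0`
making it a position (as a preparing re-centring does).  Then at the successor label `blowOneT d (shift d (shearT (C λ) A) ψ₀)` (succT's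
translated `u₁`-chart point `λ`) the branch is the permissible graph curve with datum `h₁` and re-centring `ψ′`, `ψ′(0) = 0`. -/
theorem graph_blowOneT_translate (hd : 0 < d) (A : Fin d → MvPowerSeries (Fin 2) k) (la : k) (h₁ ψ ψ₀ : MvPowerSeries (Fin 2) k)
    (hh₁ : ∀ e : Fin 2 →₀ ℕ, e 1 ≠ 0 → coeff e h₁ = 0) (hψ : constantCoeff ψ = 0) (hψ₀ : constantCoeff ψ₀ = 0)
    (hpos : IsPosT d (shift d (shearT (C la) A) ψ₀))
    (hperm : IsPermissibleTwoT d (shift d (shearT (C la + X 0 * h₁) A) ψ)) :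
    ∃ ψ' : MvPowerSeries (Fin 2) k, constantCoeff ψ' = 0 ∧
      IsPermissibleTwoT d (shift d (shearT h₁ (blowOneT d (shift d (shearT (C la) A) ψ₀))) ψ') := by
  -- split the shear and move the branch across the re-centring `ψ₀`
  rw [shearT_C_add_X_mul] at hperm
  have h2 := isPermissibleTwoT_graph_recentre (X 0 * h₁) (shearT (C la) A) ψ ψ₀ hperm
  have hψ' : constantCoeff (ψ - shear (X 0 * h₁) ψ₀) = 0 := by
    rw [map_sub, hψ, constantCoeff_shear_eq_zero _ ψ₀ hψ₀, sub_zero]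
  -- (F1) at the position `shift d (shearT (C λ) A) ψ₀`
  obtain ⟨h0, hP⟩ := hasGraphCurveT_blowOneT_of_tangent hd _ hpos h₁ _ hh₁ hψ' h2
  exact ⟨_, h0, hP⟩

/-- The same in `HasGraphCurveT` form: the successor label has a permissible graph curve (with datum `h₁`). -/
theorem hasGraphCurveT_blowOneT_translate (hd : 0 < d) (A : Fin d → MvPowerSeries (Fin 2) k) (la : k) (h₁ ψ ψ₀ : MvPowerSeries (Fin 2) k)
    (hh₁ : ∀ e : Fin 2 →₀ ℕ, e 1 ≠ 0 → coeff e h₁ = 0) (hψ : constantCoeff ψ = 0) (hψ₀ : constantCoeff ψ₀ = 0)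
    (hpos : IsPosT d (shift d (shearT (C la) A) ψ₀))
    (hperm : IsPermissibleTwoT d (shift d (shearT (C la + X 0 * h₁) A) ψ)) :
    HasGraphCurveT d (blowOneT d (shift d (shearT (C la) A) ψ₀)) := by
  obtain ⟨ψ', h0, hP⟩ := graph_blowOneT_translate hd A la h₁ ψ ψ₀ hh₁ hψ hψ₀ hpos hperm
  exact ⟨h₁, ψ', hh₁, h0, hP⟩

/-! ## (F4) Coordinate-curve moves do not touch the branch datum: the blow-up of `V(y, u₁)` -/

/-- Killing `u₂` keeps exactly the `u₂`-free coefficients (general exponent). -/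
theorem coeff_subst_killTwo (F : MvPowerSeries (Fin 2) k) (e : Fin 2 →₀ ℕ) :
    coeff e (subst (![X 0, 0] : Fin 2 → MvPowerSeries (Fin 2) k) F) = if e 1 = 0 then coeff e F else 0 := by
  classical
  split_ifs with he
  · have he' : e = Finsupp.single 0 (e 0) := by
      ext i; fin_cases i
      · simp
      · simpa using he
    rw [he']
    exact coeff_single_subst_killTwo F (e 0)
  · have hs : HasSubst (![X 0, 0] : Fin 2 → MvPowerSeries (Fin 2) k) :=
      hasSubst_of_constantCoeff_zero fun i => by fin_cases i <;> simp [constantCoeff_X]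
    rw [coeff_subst hs]
    refine finsum_eq_zero_of_forall_eq_zero fun d' => ?_
    rw [Finsupp.prod_fintype _ _ (fun i => by simp), Fin.prod_univ_two]
    simp only [Matrix.cons_val_zero, Matrix.cons_val_one]
    by_cases hd1 : d' 1 = 0
    · rw [hd1, pow_zero, mul_one, coeff_X_pow, if_neg, smul_zero]
      intro h
      rw [h] at he
      simp at he
    · rw [zero_pow hd1, mul_zero, map_zero, smul_zero]

/-- Re-centring by a multiple of `u₂` keeps `V(y, u₂)` permissible (the `u₂`-twin of `PolyDescent.isPermissibleOneT_shift_X_mul`). -/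
theorem isPermissibleTwoT_shift_X_one_mul {S : Fin d → MvPowerSeries (Fin 2) k} (hS : IsPermissibleTwoT d S) (g : MvPowerSeries (Fin 2) k) :
    IsPermissibleTwoT d (shift d S (X 1 * g)) := by
  -- divisibility form
  have hdvd : ∀ j : Fin d, X 1 ^ (d - (j : ℕ)) ∣ S j := by
    intro j
    rw [X_pow_dvd_iff]
    intro m hm
    by_contra hne
    exact absurd (hS j m hne) (not_le.mpr hm)
  intro i e he
  by_contra hlt
  push Not at hlt
  apply he
  have hdiv : X 1 ^ (d - (i : ℕ)) ∣ shift d S (X 1 * g) i := by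
    rw [shift_eq]
    refine dvd_add ?_ (Finset.dvd_sum fun j _ => ?_)
    · exact Dvd.dvd.mul_left (by rw [mul_pow]; exact Dvd.dvd.mul_right (dvd_refl _) _) _
    · by_cases hji : (j : ℕ) < (i : ℕ)
      · rw [Nat.choose_eq_zero_of_lt hji, Nat.cast_zero, zero_mul, zero_mul]; exact dvd_zero _
      · push Not at hji
        have hsplit : d - (i : ℕ) = (d - (j : ℕ)) + ((j : ℕ) - (i : ℕ)) := by have := j.2; omega
        rw [hsplit, pow_add]
        exact mul_dvd_mul (Dvd.dvd.mul_left (hdvd j) _) (by rw [mul_pow]; exact Dvd.dvd.mul_right (dvd_refl _) _)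
  exact (X_pow_dvd_iff.mp hdiv) e hlt

/-- CANONICAL PRESENTATION of a graph branch: the re-centring may be taken `u₂`-free — `IsPermissibleTwoT d (shift d B φ)` implies the same for
`φ(u₁, 0)` (the two re-centrings differ by a multiple of `ũ₂`, which is in the curve's ideal). -/
theorem isPermissibleTwoT_shift_killTwo {B : Fin d → MvPowerSeries (Fin 2) k} {φ : MvPowerSeries (Fin 2) k}
    (hperm : IsPermissibleTwoT d (shift d B φ)) :
    IsPermissibleTwoT d (shift d B (subst (![X 0, 0] : Fin 2 → MvPowerSeries (Fin 2) k) φ)) := by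
  set φ₀ := subst (![X 0, 0] : Fin 2 → MvPowerSeries (Fin 2) k) φ with hφ₀
  -- `φ − φ₀` is a multiple of `u₂`
  have hdvd : X 1 ∣ φ - φ₀ := by
    rw [X_dvd_iff]
    intro e he
    rw [map_sub, hφ₀, coeff_subst_killTwo, if_pos he, sub_self]
  obtain ⟨ρ, hρ⟩ := hdvd
  have hφ : φ = X 1 * ρ + φ₀ := by rw [← hρ, sub_add_cancel]
  -- `shift B φ₀ = shift (shift B φ) (X 1 · (−ρ))`
  have h := isPermissibleTwoT_shift_X_one_mul hperm (-ρ)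
  rwa [shift_shift, hφ, mul_neg, neg_add_cancel_left] at h

/-- A shear keeps `V(y, u₁)` permissible (`u₁`-divisibility is preserved by `u₂ ↦ u₂ + u₁h`). -/
theorem isPermissibleOneT_shearT (h : MvPowerSeries (Fin 2) k) {A : Fin d → MvPowerSeries (Fin 2) k} (hA : IsPermissibleOneT d A) :
    IsPermissibleOneT d (shearT h A) := by
  rw [isPermissibleOneT_iff_X_pow_dvd] at hA ⊢
  intro j
  obtain ⟨q, hq⟩ := hA j
  refine ⟨shear h q, ?_⟩
  show shear h (A j) = _
  rw [hq, shear_X_pow_mul]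

/-- `IsPermissibleTwoT` is preserved by `divOneT` (dividing by powers of `u₁` keeps `u₂`-exponents). -/
theorem isPermissibleTwoT_divOneT {B : Fin d → MvPowerSeries (Fin 2) k} (h : IsPermissibleTwoT d B) :
    IsPermissibleTwoT d (divOneT d B) := by
  intro j e he
  have he' : coeff e (divOne (d - (j : ℕ)) (B j)) ≠ 0 := he
  rw [coeff_divOne] at he'
  simpa using h j _ he'

/-- **(F4) NO RAISE UNDER THE `V(y, u₁)`-MOVE.**  If `V(y, u₁)` is permissible for the position `A` (succT's first case) and the graph curve
`V(y + φ, u₂ + u₁h)` is permissible too, then after the curve blow-up `divOneT` the branch is again a permissible graph curve of `divOneT d A`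
with the SAME datum `h` (its strict transform passes through the unique near point and keeps its contact with `V(u₂)`). -/
theorem graph_divOneT (hd : 0 < d) (A : Fin d → MvPowerSeries (Fin 2) k) (hA : IsPosT d A) (hA1 : IsPermissibleOneT d A)
    (h φ : MvPowerSeries (Fin 2) k) (hφ : constantCoeff φ = 0) (hperm : IsPermissibleTwoT d (shift d (shearT h A) φ)) :
    ∃ φ' : MvPowerSeries (Fin 2) k, constantCoeff φ' = 0 ∧ IsPermissibleTwoT d (shift d (shearT h (divOneT d A)) φ') := by
  set B := shearT h A with hB
  have hB1 : IsPermissibleOneT d B := isPermissibleOneT_shearT h hA1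
  have hBpos : IsPosT d B := isPosT_shearT h hA
  -- canonical `u₂`-free re-centring `φ₀ = φ(u₁, 0) = u₁ · g`
  set φ₀ := subst (![X 0, 0] : Fin 2 → MvPowerSeries (Fin 2) k) φ with hφ₀
  have hperm₀ : IsPermissibleTwoT d (shift d B φ₀) := isPermissibleTwoT_shift_killTwo hperm
  have hφ₀0 : constantCoeff φ₀ = 0 := by
    rw [← coeff_zero_eq_constantCoeff_apply, hφ₀, coeff_subst_killTwo, if_pos (Finsupp.zero_apply), coeff_zero_eq_constantCoeff_apply, hφ]
  have hdvd : X 0 ∣ φ₀ := by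
    rw [X_dvd_iff]
    intro e he0
    by_cases he1 : e 1 = 0
    · have : e = 0 := by
        ext i; fin_cases i
        · simpa using he0
        · simpa using he1
      rw [this, coeff_zero_eq_constantCoeff_apply, hφ₀0]
    · rw [hφ₀, coeff_subst_killTwo, if_neg he1]
  obtain ⟨g, hg⟩ := hdvd
  -- `g(0) = ∂φ₀/∂u₁(0) = 0`
  have hg0 : constantCoeff g = 0 := by
    have h1 : coeff (Finsupp.single 0 1) φ₀ = 0 := coeff_X_zero_eq_zero_of_isPermissibleTwoT_shift hd hBpos hφ₀0 hperm₀
    rw [hg, show (Finsupp.single (0 : Fin 2) 1) = Finsupp.single 0 1 + 0 by rw [add_zero], X, coeff_monomial_mul,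
      if_pos (by simp)] at h1
    simpa using h1
  refine ⟨g, hg0, ?_⟩
  have h2 := isPermissibleTwoT_divOneT hperm₀
  rw [hg, divOneT_shift B g hB1, hB, divOneT_shearT h hA1] at h2
  exact h2

end TOT2Curve

end Summit.ResolutionOfSingularities.ResolutionOfSingularities.Theorems

end
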